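/-
Lead seat `ym-line-sgb-p1` (prover-ym-line-sgb-p1-g0-0), route `SteinGapBootstrap` (rev 2), crux K2 `GapGivesClusteringG`
(stmt-QuantumFields-22999): the crux with the coupling restricted to `β ≥ 0`, assembled from the width seats' landed stubs
(`…StubPairFormSymm`, `…StubPolarisationBound`) and gauge-boot's site-plane reflection positivity of torus limit points.
-/
import Summits.QuantumFields.YangMills.Theorems.SteinGapBootstrapGapGivesClusteringGStubPairFormSymm
import Summits.QuantumFields.YangMills.Theorems.SteinGapBootstrapGapGivesClusteringGStubPolarisationBound
import Summits.QuantumFields.GaugeBoot.ClassBLimitSiteRP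
import HarnessLib

/-!
# Route `SteinGapBootstrap`, crux K2 `GapGivesClusteringG`: the RP-spectral gap gives pair clustering — for every `β ≥ 0`

NOT THE CLAY GAP (the route bears on the RECORD-label rung R2ξ′ `WeakCouplingRates.XiPow`, an UPPER bound on the lattice mass gap;
nothing here bounds a gap from below, and no summit statement is touched).

Item `stmt-QuantumFields-22999` (`Summit.QuantumFields.YangMills.Theses.SteinGapBootstrap.GapGivesClusteringG`): for a torus-limit
state `μ` of the 4-D Wilson theory (compact simple `G`, faithful unitary `r`) and `m` with the DIAGONAL, one-sided RP-spectral gap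
`HasRPTimeGap μ m`, the OFF-DIAGONAL pair bound `|∫ A(θU) B(α_t U) dμ - ∫ A∘θ dμ ∫ B∘α_t dμ| ≤ 2 e^{-mt} a b` for positive-time
`A, B` bounded by `a, b`.

STATE OF THE CRUX after the width seats' files: `abs_pairCorr_le_of_rpZero` (`…StubPolarisationBound`) reduces the bound to
(a) symmetry of the time-zero pair form — `pairForm_symm` (`…StubPairFormSymm`, every real `β`, limits along tori of any parity) —
and (b) TIME-ZERO site-plane reflection positivity `0 ≤ rpCorr μ F 0` of the limit state for positive-time `F`.  This file supplies
(b) for EVERY `β ≥ 0` and every torus-limit state (either parity), from gauge-boot's `siteRP_zero_of_mem_infiniteVolumeLimitPoints`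
(Class-B identification brick: site-plane RP holds on even tori by factorisation and on odd tori `L ≥ 3` by the Osterwalder–Seiler
treatment of the antipodal link plane — the step that needs `β ≥ 0` — and passes to weak limits), and assembles:

* `timeReflectLG_eq_configSiteReflect` — P3's site reflection `θ = timeReflectLG` IS gauge-boot's `configSiteReflect 0` (`rfl`);
* `integral_reflect_mul_self_nonneg_of_siteRP` — gauge-boot's complex RP axiom ⇒ `0 ≤ ∫ F(θU) F(U) dμ` for positive-time real `F`;
* `rpCorr_zero_nonneg_of_rp` — `0 ≤ ∫ F∘θ · F` for all positive-time `F` ⇒ `0 ≤ rpCorr μ F 0` (RP of `F - c`, `c` the mean of the two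
  means; no reflection invariance used);
* `rpCorr_zero_nonneg_of_mem_limitPoints` — (b) for `β ≥ 0`, all torus-limit states;
* `gapGivesClusteringG_of_nonneg` — **the crux statement VERBATIM with `0 ≤ β →` inserted after `∀ β : ℝ,`**.

WHAT IS NOT HERE.  The crux AS FILED quantifies over all real `β`.  For `β < 0` the one missing input is (b): time-zero site-plane
RP of torus-limit states at NEGATIVE coupling, which is neither in the tree nor in print — on odd tori the antipodal plane of the site
reflection `x₀ ↦ -x₀` bisects links, and its Osterwalder–Seiler crossing kernel `exp(β Re tr(A*B))` is of positive type iff `β ≥ 0`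
(for `U(1)` its first Fourier coefficient is `I₁(β) < 0` when `β < 0`).  Without (b) the diagonal hypothesis `HasRPTimeGap` does not
control off-diagonal correlators at all (a symmetric Hankel family `q₀ = v > 0`, `q_t = -c` for `t ≥ 1` satisfies every instance of the
diagonal bound and violates the conclusion).  The route's Assembly consumes K2 only at `β ≥ β₀ → ∞`.

References: K. Osterwalder, E. Seiler, Ann. Phys. 110 (1978) 440, §2–3; J. Fröhlich, R. Israel, E. H. Lieb, B. Simon, Commun. Math.
Phys. 62 (1978) 1, Thm. 2.1; E. Seiler, LNP 159 (1982) Ch. 2; J. Glimm, A. Jaffe, Quantum Physics (1987) §6.1.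
-/

set_option autoImplicit false

noncomputable section

open MeasureTheory Filter Topology
open scoped ComplexConjugate ComplexOrder
open Literature.MathematicalPhysics Literature.MathematicalPhysics.QuantumFieldTheory
  Literature.MathematicalPhysics.QuantumLattice
open Summit.QuantumFields.GaugeBoot (configSiteReflect siteHalfEdges IsReflectionPositiveFor
  siteRP_zero_of_mem_infiniteVolumeLimitPoints)
open Summit.QuantumFields.YangMills.Theorems.WeakCouplingRates

namespace Summit.QuantumFields.YangMills.Theorems.SteinGapBootstrap

section SiteRPZero

variable {G : Type} [Group G] [TopologicalSpace G] [IsTopologicalGroup G] [CompactSpace G]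
  [MeasurableSpace G] [BorelSpace G] {μ : Measure (LGConfig 4 G)}

omit [TopologicalSpace G] [IsTopologicalGroup G] [CompactSpace G] [MeasurableSpace G] [BorelSpace G] in
/-- P3's site time-reflection `θ = timeReflectLG` (the currency of `HasRPTimeGap`) IS gauge-boot's axis-`0` site reflection
`configSiteReflect 0` (`x₀ ↦ -x₀`, temporal links reversed and inverted) — definitionally. [folklore] -/
theorem timeReflectLG_eq_configSiteReflect :
    (timeReflectLG : LGConfig 4 G → LGConfig 4 G) = configSiteReflect 0 := rfl

omit [IsTopologicalGroup G] [CompactSpace G] in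
/-- **Gauge-boot's site-RP axiom, read in P3's currency.**  If `μ` is reflection positive for `(configSiteReflect 0, siteHalfEdges 0)`
(`0 ≤ ∫ (F∘Θ)‾ F dμ` for bounded measurable complex `F` depending only on links with `x₀ ≥ 0`), then `0 ≤ ∫ F(θU) F(U) dμ` for every
positive-time observable `F` (`IsPosTimeObs`: bounded continuous real cylinder function supported on links with `x₀ ≥ 0`). [folklore] -/
theorem integral_reflect_mul_self_nonneg_of_siteRP [SecondCountableTopology G]
    (h : IsReflectionPositiveFor (configSiteReflect (G := G) 0) (siteHalfEdges 0) μ)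
    {F : LGConfig 4 G → ℝ} (hF : IsPosTimeObs F) : 0 ≤ ∫ U, F (timeReflectLG U) * F U ∂μ := by
  obtain ⟨S, hS, hS0⟩ := hF.cyl
  obtain ⟨C, hC⟩ := hF.bdd
  have hm : Measurable F := hF.cont.measurable
  have hdep : DependsOn (fun U => ((F U : ℝ) : ℂ)) (siteHalfEdges (d := 4) 0) := by
    intro U V hUV
    have hFUV : F U = F V := hS fun e he => hUV e (hS0 e (Finset.mem_coe.1 he))
    simp only [hFUV]
  have h1 := h (fun U => ((F U : ℝ) : ℂ)) (Complex.measurable_ofReal.comp hm)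
    ⟨C, fun U => by rw [Complex.norm_real, Real.norm_eq_abs]; exact hC U⟩ hdep
  have h2 : (fun U => (starRingEnd ℂ) ((F (configSiteReflect 0 U) : ℝ) : ℂ) * ((F U : ℝ) : ℂ)) =
      fun U => ((F (timeReflectLG U) * F U : ℝ) : ℂ) := by
    funext U
    rw [Complex.conj_ofReal, ← Complex.ofReal_mul, timeReflectLG_eq_configSiteReflect]
  rw [h2, integral_complex_ofReal] at h1
  exact Complex.zero_le_real.1 h1

omit [CompactSpace G] in
/-- **Time-zero RP of the pairing ⇒ non-negativity of the CONNECTED time-zero correlator**: if `0 ≤ ∫ F(θU) F(U) dμ` for every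
positive-time `F`, then `(∫ F∘θ dμ)(∫ F dμ) ≤ ∫ F(θU) F(U) dμ`, i.e. `0 ≤ rpCorr μ F 0` — RP applied to `F - c` with `c` the mean of
the two means (no reflection invariance of `μ` is used; the argument of `WeakCouplingRates.rpCorr_zero_nonneg`). [folklore] -/
theorem rpCorr_zero_nonneg_of_rp [SecondCountableTopology G] [IsProbabilityMeasure μ]
    (hRP : ∀ F : LGConfig 4 G → ℝ, IsPosTimeObs F → 0 ≤ ∫ U, F (timeReflectLG U) * F U ∂μ)
    {F : LGConfig 4 G → ℝ} (hF : IsPosTimeObs F) : 0 ≤ rpCorr μ F 0 := by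
  obtain ⟨Λ, hFΛ, hΛ⟩ := hF.cyl
  obtain ⟨C, hC⟩ := hF.bdd
  set a : ℝ := ∫ U, F (timeReflectLG U) ∂μ with ha
  set b : ℝ := ∫ U, F U ∂μ with hb
  set c : ℝ := (a + b) / 2 with hc
  -- RP for the positive-time observable `F - c`
  have hpos : IsPosTimeObs (fun U => F U - c) :=
    ⟨⟨Λ, isCylinder_sub_const hFΛ c, hΛ⟩, hF.cont.sub continuous_const,
      C + |c|, fun U => by linarith [abs_sub (F U) c, hC U]⟩
  have hrp := hRP _ hpos
  -- integrability of the pieces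
  have hθc : Continuous fun U => F (timeReflectLG U) := hF.cont.comp continuous_timeReflectLG
  have hiθ : Integrable (fun U => F (timeReflectLG U)) μ :=
    Integrable.of_bound hθc.measurable.aestronglyMeasurable C (ae_of_all _ fun U => by
      simpa [Real.norm_eq_abs] using hC (timeReflectLG U))
  have hiF : Integrable F μ :=
    Integrable.of_bound hF.cont.measurable.aestronglyMeasurable C (ae_of_all _ fun U => by
      simpa [Real.norm_eq_abs] using hC U)
  have hiprod : Integrable (fun U => F (timeReflectLG U) * F U) μ :=
    Integrable.of_bound (hθc.mul hF.cont).measurable.aestronglyMeasurable (C * C)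
      (ae_of_all _ fun U => by
        rw [Real.norm_eq_abs, abs_mul]
        exact mul_le_mul (hC _) (hC _) (abs_nonneg _) ((abs_nonneg (F U)).trans (hC U)))
  -- expand `∫ (F∘θ - c)(F - c) = ∫ F∘θ·F - c b - c a + c²`
  have hexp : ∫ U, (F (timeReflectLG U) - c) * (F U - c) ∂μ =
      (∫ U, F (timeReflectLG U) * F U ∂μ) - c * b - c * a + c * c := by
    have h1 : (fun U => (F (timeReflectLG U) - c) * (F U - c)) =
        fun U => F (timeReflectLG U) * F U - c * F U - c * F (timeReflectLG U) + c * c := by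
      funext U; ring
    rw [h1, integral_add, integral_sub, integral_sub, integral_const_mul, integral_const_mul, integral_const]
    · simp [ha, hb]
    · exact hiprod
    · exact hiF.const_mul c
    · exact hiprod.sub (hiF.const_mul c)
    · exact hiθ.const_mul c
    · exact (hiprod.sub (hiF.const_mul c)).sub (hiθ.const_mul c)
    · exact integrable_const _
  have hkey : c * b + c * a - c * c ≤ ∫ U, F (timeReflectLG U) * F U ∂μ := by
    linarith [hexp ▸ hrp]
  have hamgm : a * b ≤ c * b + c * a - c * c := by
    rw [hc]; nlinarith [sq_nonneg (a - b)]
  simp only [rpCorr, timeShiftLG_zero]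
  linarith

variable {N : ℕ} (ρ : G →* Matrix (Fin N) (Fin N) ℂ)

/-- **Time-zero site-plane reflection positivity of torus-limit states, `β ≥ 0`, EITHER parity.**  For a continuous model `ρ`,
`0 ≤ β`, and every `μ ∈ infiniteVolumeLimitPoints ρ β` (weak limits of the torus Wilson states along ANY subsequence of sides
`L_k + 1`, odd or even): `0 ≤ rpCorr μ F 0` for every positive-time observable `F`.  From gauge-boot's
`siteRP_zero_of_mem_infiniteVolumeLimitPoints` (even tori: `wilsonExpectation_siteReflectionPositive`; odd tori `L ≥ 3`:
`torus_siteRP_nonneg_odd`; weak limit).  The tree's earlier `WeakCouplingRates.rpCorr_zero_nonneg` covered `oddTorusLimitPoints` only.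
[folklore] -/
theorem rpCorr_zero_nonneg_of_mem_limitPoints [T2Space G] [SecondCountableTopology G] (hρ : Continuous ρ) {β : ℝ} (hβ : 0 ≤ β)
    (hμ : μ ∈ infiniteVolumeLimitPoints (d := 4) ρ β) [IsProbabilityMeasure μ] {F : LGConfig 4 G → ℝ} (hF : IsPosTimeObs F) :
    0 ≤ rpCorr μ F 0 :=
  rpCorr_zero_nonneg_of_rp
    (fun _ hF' => integral_reflect_mul_self_nonneg_of_siteRP (siteRP_zero_of_mem_infiniteVolumeLimitPoints ρ hρ hβ hμ) hF') hF

end SiteRPZero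

/-! ### The crux with `β ≥ 0` -/

/-- **K2 `GapGivesClusteringG` for every `β ≥ 0`** — the crux statement verbatim with `0 ≤ β →` inserted: for every compact simple
`G`, faithful unitary lattice representation `r`, every `β ≥ 0`, every torus-limit state `μ ∈ infiniteVolumeLimitPoints r.ρ β` of the
4-D Wilson theory (limits along tori of either parity) and every `m` with `HasRPTimeGap μ m`, all positive-time observables `A, B`
bounded by `a, b` and every `t : ℕ` satisfy `|∫ A(θU) B(α_t U) dμ - ∫ A∘θ dμ ∫ B∘α_t dμ| ≤ 2 e^{-mt} a b`.  Assembly: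
`abs_pairCorr_le_of_rpZero` (Cauchy–Schwarz at time `0`, gap hypothesis at time `2t`) + `pairForm_symm` (θ- and translation
invariance of limit states, all `β`) + `rpCorr_zero_nonneg_of_mem_limitPoints` (site RP, `β ≥ 0`).  This is the form the route's
Assembly consumes (`β ≥ β₀ → ∞`).  NOT THE CLAY GAP. [folklore] -/
theorem gapGivesClusteringG_of_nonneg :
    ∀ (G : Type) [Group G] [TopologicalSpace G] [IsTopologicalGroup G] [CompactSpace G],
      IsCompactSimpleLieGroup G →
      letI : MeasurableSpace G := borel G
      haveI : BorelSpace G := ⟨rfl⟩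
      ∀ r : LatticeRep G, ∀ β : ℝ, 0 ≤ β → ∀ μ ∈ infiniteVolumeLimitPoints (d := 4) r.ρ β, ∀ m : ℝ,
        HasRPTimeGap μ m → ∀ (A B : LGConfig 4 G → ℝ), IsPosTimeObs A → IsPosTimeObs B → ∀ a b : ℝ,
        (∀ U, |A U| ≤ a) → (∀ U, |B U| ≤ b) → ∀ t : ℕ,
        |(∫ U, A (timeReflectLG U) * B (timeShiftLG (G := G) t U) ∂μ) -
            (∫ U, A (timeReflectLG U) ∂μ) * (∫ U, B (timeShiftLG (G := G) t U) ∂μ)|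
          ≤ 2 * Real.exp (-(m * t)) * a * b := by
  intro G _ _ _ _ _hG
  letI : MeasurableSpace G := borel G
  haveI : BorelSpace G := ⟨rfl⟩
  intro r β hβ μ hμ m hm A B hA hB a b ha hb t
  haveI : T2Space G := (r.continuous.isClosedEmbedding r.injective).isEmbedding.t2Space
  haveI : SecondCountableTopology G :=
    (r.continuous.isClosedEmbedding r.injective).isEmbedding.secondCountableTopology
  haveI : IsProbabilityMeasure μ := by obtain ⟨_, _, hprob, _⟩ := hμ; exact hprob
  refine abs_pairCorr_le_of_rpZero r.ρ hμ
    (fun F hF => rpCorr_zero_nonneg_of_mem_limitPoints r.ρ r.continuous hβ hμ hF)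
    (fun A' B' hA' hB' => ?_) hm hA hB ha hb t
  obtain ⟨SA, hAS, -⟩ := hA'.cyl
  obtain ⟨SB, hBS, -⟩ := hB'.cyl
  have h := pairForm_symm r.ρ r.continuous hμ hAS hA'.cont hA'.bdd hBS hB'.cont hB'.bdd 0
  simpa only [timeShiftLG_zero] using h

end Summit.QuantumFields.YangMills.Theorems.SteinGapBootstrap

end
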